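import Mathlib
import Literature.MathematicalPhysics.QuantumLattice.DWaveSource
import Literature.MathematicalPhysics.QuantumLattice.DWaveSourceProofs
import Literature.MathematicalPhysics.QuantumLattice.FinDimSpectrum
import Literature.MathematicalPhysics.QuantumLattice.GibbsPressureTemperature

/-!
Sketch for crux-ideate stmt-HubbardSuperconductivity-1697 (TwSourcedCondensation), ideator 3
(generation 2: the abstract ratchet of generation 1 had a wrong coefficient — `- log Z(β₁/2,K₁)`
instead of `- 2·log Z(β₁/2,K₁)` — and was FALSE as stated (e.g. `K₀ = K₁ = -1` on a point);
corrected here and PROVED from the tree's `GibbsPressureTemperature` toolkit; the torus form was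
already correct and is now proved; the Schwarz floor is proved from Mathlib's Schwarz lemma).

First lemmas of the two idea cards of this seat:
* `thermalRatchet`, `thermalRatchet_dWaveSource` — card `thermal-ratchet` (both proved);
* `schwarzFloor`, `floor_of_complexCoupling_modulus_family` (general holomorphic family `K w`,
  triage r1-3 sharpening), `floor_of_complexCoupling_modulus` (affine corollary) — card
  `schwarz-sign-transfer` (all proved).
-/

set_option linter.dupNamespace false

namespace Summit.HubbardSuperconductivity.HubbardSuperconductivity.Cruxes.TwSourcedCondensation.Sketch

open Matrix Literature.MathematicalPhysics.QuantumLattice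

section Ratchet

variable {n : Type*} [Fintype n] [DecidableEq n] [Nonempty n]

/-- CARD thermal-ratchet, first lemma (abstract finite-dimensional form, CORRECTED coefficient).
For Hermitian `K₀ K₁` and `0 < β₁ ≤ β`, with `P_i(b) := log Z(b, K_i)`:
`(2P₁(β₁) - 2P₁(β₁/2) - P₀(β₁))/β₁ ≤ (P₁(β) - P₀(β))/β`.
Proof: `P₀(b)/b` is antitone (`log_partitionFn_div_antitone`); the pressure increment of `K₁`
between `β₁` and `β` is paid in entropy (`pressure_sub_pressure_le_entropy`), the entropy at `β₁`
is at most the dyadic increment `2P₁(β₁/2) - P₁(β₁)` (`entropy_le_two_mul_log_partitionFn_half_sub`),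
which is `≥ 0` by antitonicity again. -/
theorem thermalRatchet (K₀ K₁ : Matrix n n ℂ) (hK₀ : K₀.IsHermitian) (hK₁ : K₁.IsHermitian)
    {β₁ β : ℝ} (hβ₁ : 0 < β₁) (hle : β₁ ≤ β) :
    (2 * Real.log (Matrix.partitionFn β₁ K₁).re - 2 * Real.log (Matrix.partitionFn (β₁ / 2) K₁).re
        - Real.log (Matrix.partitionFn β₁ K₀).re) / β₁
      ≤ (Real.log (Matrix.partitionFn β K₁).re - Real.log (Matrix.partitionFn β K₀).re) / β := by
  have hβ : 0 < β := lt_of_lt_of_le hβ₁ hle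
  have h0 := log_partitionFn_div_antitone hK₀ hβ₁ hle
  have h1 := pressure_sub_pressure_le_entropy hK₁ hβ hβ₁
  have h2 := entropy_le_two_mul_log_partitionFn_half_sub hK₁ hβ₁
  have h3 := log_partitionFn_div_antitone hK₁ (half_pos hβ₁) (half_le_self hβ₁.le)
  set A := Real.log (Matrix.partitionFn β₁ K₁).re with hA
  set Ah := Real.log (Matrix.partitionFn (β₁ / 2) K₁).re with hAh
  set Aβ := Real.log (Matrix.partitionFn β K₁).re with hAβ
  set B := Real.log (Matrix.partitionFn β₁ K₀).re with hB
  set Bβ := Real.log (Matrix.partitionFn β K₀).re with hBβ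
  set S := A + β₁ * (Matrix.gibbsState β₁ K₁ K₁).re with hS
  -- the dyadic increment is non-negative
  have hX : 0 ≤ 2 * Ah - A := by
    have h3' : A ≤ Ah / (β₁ / 2) * β₁ := (div_le_iff₀ hβ₁).mp h3
    have : Ah / (β₁ / 2) * β₁ = 2 * Ah := by field_simp
    linarith
  have hcoef : 0 ≤ (β - β₁) / (β * β₁) := div_nonneg (by linarith) (by positivity)
  have hcoef' : (β - β₁) / (β * β₁) ≤ 1 / β₁ := by
    have h : 1 / β₁ - (β - β₁) / (β * β₁) = 1 / β := by field_simp; ring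
    have : 0 < 1 / β := one_div_pos.2 hβ
    linarith
  have h4 : A / β₁ - Aβ / β ≤ (2 * Ah - A) / β₁ := by
    calc A / β₁ - Aβ / β ≤ (β - β₁) / (β * β₁) * S := h1
      _ ≤ (β - β₁) / (β * β₁) * (2 * Ah - A) := mul_le_mul_of_nonneg_left h2 hcoef
      _ ≤ 1 / β₁ * (2 * Ah - A) := mul_le_mul_of_nonneg_right hcoef' hX
      _ = (2 * Ah - A) / β₁ := by ring
  have e1 : (2 * A - 2 * Ah - B) / β₁ = A / β₁ - (2 * Ah - A) / β₁ - B / β₁ := by ring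
  have e2 : (Aβ - Bβ) / β = Aβ / β - Bβ / β := by ring
  rw [e1, e2]
  linarith

end Ratchet

/-- CARD thermal-ratchet, first lemma specialised to the sourced Hubbard torus:
with `p b s := log Z(b, dWaveSourceTorus L U μ s) / (b L²)`, for `0 < β₁ ≤ β`,
`p β h - p β 0 ≥ [p β₁ h - p β₁ 0] - [p (β₁/2) h - p β₁ h]`
(equal-scale sourced gain minus a specific-heat term of the SOURCED model between temperatures
`1/β₁` and `2/β₁`). Used with `β₁ = κ/|h|`. -/
theorem thermalRatchet_dWaveSource (L : ℕ) [NeZero L] (U μ h : ℝ) {β₁ β : ℝ}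
    (hβ₁ : 0 < β₁) (hle : β₁ ≤ β) :
    ((Real.log (Matrix.partitionFn β₁ (dWaveSourceTorus L U μ h)).re / (β₁ * (L : ℝ) ^ 2)
        - Real.log (Matrix.partitionFn β₁ (dWaveSourceTorus L U μ 0)).re / (β₁ * (L : ℝ) ^ 2))
      - (Real.log (Matrix.partitionFn (β₁ / 2) (dWaveSourceTorus L U μ h)).re / (β₁ / 2 * (L : ℝ) ^ 2)
        - Real.log (Matrix.partitionFn β₁ (dWaveSourceTorus L U μ h)).re / (β₁ * (L : ℝ) ^ 2)))
      ≤ Real.log (Matrix.partitionFn β (dWaveSourceTorus L U μ h)).re / (β * (L : ℝ) ^ 2)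
        - Real.log (Matrix.partitionFn β (dWaveSourceTorus L U μ 0)).re / (β * (L : ℝ) ^ 2) := by
  have hβ : 0 < β := lt_of_lt_of_le hβ₁ hle
  have hK := isHermitian_hubbardTorusWith L 1 U μ
  have hK₁ := dWaveSourceTorus_isHermitian L hK h
  have hK₀ := dWaveSourceTorus_isHermitian L hK 0
  have key := thermalRatchet _ _ hK₀ hK₁ hβ₁ hle
  have hL : (0 : ℝ) < (L : ℝ) ^ 2 := by
    have : (0 : ℝ) < (L : ℝ) := by exact_mod_cast Nat.pos_of_ne_zero (NeZero.ne L)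
    positivity
  set A := Real.log (Matrix.partitionFn β₁ (dWaveSourceTorus L U μ h)).re
  set Ah := Real.log (Matrix.partitionFn (β₁ / 2) (dWaveSourceTorus L U μ h)).re
  set Aβ := Real.log (Matrix.partitionFn β (dWaveSourceTorus L U μ h)).re
  set B := Real.log (Matrix.partitionFn β₁ (dWaveSourceTorus L U μ 0)).re
  set Bβ := Real.log (Matrix.partitionFn β (dWaveSourceTorus L U μ 0)).re
  have e1 : (A / (β₁ * (L : ℝ) ^ 2) - B / (β₁ * (L : ℝ) ^ 2))
      - (Ah / (β₁ / 2 * (L : ℝ) ^ 2) - A / (β₁ * (L : ℝ) ^ 2))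
      = ((2 * A - 2 * Ah - B) / β₁) / (L : ℝ) ^ 2 := by
    field_simp
    ring
  have e2 : Aβ / (β * (L : ℝ) ^ 2) - Bβ / (β * (L : ℝ) ^ 2) = ((Aβ - Bβ) / β) / (L : ℝ) ^ 2 := by
    field_simp
  rw [e1, e2]
  exact div_le_div_of_nonneg_right key hL.le

/-- CARD schwarz-sign-transfer, first lemma (abstract): Schwarz's lemma at the centre of a disc,
read on the real part. If `G` is holomorphic on `|w| < R` and `|G w - G 0| ≤ M` there, then for
real `0 ≤ U < R`, `Re G(U) ≥ Re G(0) - M U / R`. -/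
theorem schwarzFloor {R M U : ℝ} (hU : 0 ≤ U) (hUR : U < R) {G : ℂ → ℂ}
    (hG : DifferentiableOn ℂ G (Metric.ball 0 R))
    (hM : Set.MapsTo (fun w => G w - G 0) (Metric.ball 0 R) (Metric.closedBall 0 M)) :
    (G 0).re - M * (U / R) ≤ (G (U : ℂ)).re := by
  have hmaps : Set.MapsTo G (Metric.ball (0 : ℂ) R) (Metric.closedBall (G 0) M) := by
    intro w hw
    have hw' := hM hw
    simp only [Metric.mem_closedBall, dist_zero_right] at hw'
    rw [Metric.mem_closedBall, dist_eq_norm]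
    exact hw'
  have hz : ((U : ℝ) : ℂ) ∈ Metric.ball (0 : ℂ) R := by
    rw [Metric.mem_ball, dist_zero_right, Complex.norm_real, Real.norm_eq_abs, abs_of_nonneg hU]
    exact hUR
  have key := Complex.dist_le_div_mul_dist_of_mapsTo_ball hG hmaps hz
  rw [dist_zero_right, Complex.norm_real, Real.norm_eq_abs, abs_of_nonneg hU, dist_eq_norm] at key
  have hre : |(G (U : ℂ) - G 0).re| ≤ ‖G (U : ℂ) - G 0‖ := Complex.abs_re_le_norm _
  rw [Complex.sub_re] at hre
  have hmr : M / R * U = M * (U / R) := by ring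
  rw [hmr] at key
  have := neg_abs_le ((G (U : ℂ)).re - (G 0).re)
  linarith

/-- CARD schwarz-sign-transfer, first lemma (thermodynamic form): a SIGN-FREE modulus bound on
a holomorphic branch `G` of `w ↦ β⁻¹[log Z(β, A + wV - hB) - log Z(β, A + wV)]` on the coupling
disc `|w| < R` transfers the value at the free point `w = 0` to a FLOOR at the physical real
coupling `U < R`, losing only `M·U/R`. (`Z` is entire in `w`; the hypothesis `hexp` says `Z ≠ 0`
on the disc and fixes the branch; the real part of `G` at real `w` IS the true pressure difference
because `Z > 0` there — `re_eq_of_exp_mul`.) -/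
theorem re_eq_of_exp_mul_partitionFn {n : Type*} [Fintype n] [DecidableEq n] [Nonempty n]
    {H₁ H₂ : Matrix n n ℂ} (hH₁ : H₁.IsHermitian) (hH₂ : H₂.IsHermitian) {β : ℝ} (hβ : 0 < β)
    {g : ℂ} (hg : Complex.exp ((β : ℂ) * g) * Matrix.partitionFn β H₁ = Matrix.partitionFn β H₂) :
    g.re = (Real.log (Matrix.partitionFn β H₂).re - Real.log (Matrix.partitionFn β H₁).re) / β := by
  have h1 := partitionFn_re_pos hH₁ β
  have h2 := partitionFn_re_pos hH₂ β
  have hn := congrArg (fun z : ℂ => ‖z‖) hg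
  simp only [norm_mul, Complex.norm_exp, Complex.re_ofReal_mul] at hn
  rw [hH₁.partitionFn_eq_ofReal, hH₂.partitionFn_eq_ofReal, Complex.norm_real, Complex.norm_real,
    Real.norm_eq_abs, Real.norm_eq_abs] at hn
  rw [hH₁.partitionFn_eq_ofReal, hH₂.partitionFn_eq_ofReal, Complex.ofReal_re, Complex.ofReal_re]
  rw [hH₁.partitionFn_eq_ofReal, Complex.ofReal_re] at h1
  rw [hH₂.partitionFn_eq_ofReal, Complex.ofReal_re] at h2
  rw [abs_of_pos h1, abs_of_pos h2] at hn
  -- hn : Real.exp (β * g.re) * Z₁ = Z₂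
  have hlog := congrArg Real.log hn
  rw [Real.log_mul (Real.exp_pos _).ne' h1.ne', Real.log_exp] at hlog
  rw [eq_div_iff hβ.ne']
  linarith

/-- CARD schwarz-sign-transfer, first lemma for a GENERAL holomorphic family (triage r1-3 sharpening:
the fixed-Fermi-surface counterterm family `w ↦ K w` is not affine in `w`). Only the two real points
`w = 0, U` (where `K 0`, `K U` are Hermitian) and the disc enter; analyticity of `Z ∘ K` is not even
needed for the transfer itself — it is needed upstream to produce the holomorphic branch `G`. -/
theorem floor_of_complexCoupling_modulus_family {n : Type*} [Fintype n] [DecidableEq n] [Nonempty n]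
    (K : ℂ → Matrix n n ℂ) (B : Matrix n n ℂ) {U : ℝ} (hK0 : (K 0).IsHermitian)
    (hKU : (K (U : ℂ)).IsHermitian) (hB : B.IsHermitian)
    {β : ℝ} (hβ : 0 < β) {R M : ℝ} (hU : 0 ≤ U) (hUR : U < R) (h : ℝ) (G : ℂ → ℂ)
    (hG : DifferentiableOn ℂ G (Metric.ball 0 R))
    (hexp : ∀ w ∈ Metric.ball (0 : ℂ) R,
      Complex.exp ((β : ℂ) * G w) * Matrix.partitionFn β (K w) =
        Matrix.partitionFn β (K w - (h : ℂ) • B))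
    (hM : ∀ w ∈ Metric.ball (0 : ℂ) R, ‖G w - G 0‖ ≤ M) :
    (Real.log (Matrix.partitionFn β (K 0 - (h : ℂ) • B)).re
        - Real.log (Matrix.partitionFn β (K 0)).re) / β - M * (U / R)
      ≤ (Real.log (Matrix.partitionFn β (K (U : ℂ) - (h : ℂ) • B)).re
        - Real.log (Matrix.partitionFn β (K (U : ℂ))).re) / β := by
  have hR : 0 < R := lt_of_le_of_lt hU hUR
  have hrealh : IsSelfAdjoint (h : ℂ) := by
    rw [isSelfAdjoint_iff, Complex.star_def, Complex.conj_ofReal]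
  have hhB : ((h : ℂ) • B).IsHermitian := hB.smul hrealh
  have hzU : ((U : ℝ) : ℂ) ∈ Metric.ball (0 : ℂ) R := by
    rw [Metric.mem_ball, dist_zero_right, Complex.norm_real, Real.norm_eq_abs, abs_of_nonneg hU]
    exact hUR
  have hz0 : (0 : ℂ) ∈ Metric.ball (0 : ℂ) R := Metric.mem_ball_self hR
  have rU := re_eq_of_exp_mul_partitionFn hKU (hKU.sub hhB) hβ (hexp (U : ℂ) hzU)
  have r0 := re_eq_of_exp_mul_partitionFn hK0 (hK0.sub hhB) hβ (hexp 0 hz0)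
  have hmaps : Set.MapsTo (fun w => G w - G 0) (Metric.ball 0 R) (Metric.closedBall 0 M) := by
    intro w hw
    rw [Metric.mem_closedBall, dist_zero_right]
    exact hM w hw
  have key := schwarzFloor hU hUR hG hmaps
  rw [rU, r0] at key
  exact key

theorem floor_of_complexCoupling_modulus {n : Type*} [Fintype n] [DecidableEq n] [Nonempty n]
    (A V B : Matrix n n ℂ) (hA : A.IsHermitian) (hV : V.IsHermitian) (hB : B.IsHermitian)
    {β : ℝ} (hβ : 0 < β) {R M U : ℝ} (hU : 0 ≤ U) (hUR : U < R) (h : ℝ) (G : ℂ → ℂ)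
    (hG : DifferentiableOn ℂ G (Metric.ball 0 R))
    (hexp : ∀ w ∈ Metric.ball (0 : ℂ) R,
      Complex.exp ((β : ℂ) * G w) * Matrix.partitionFn β (A + w • V) =
        Matrix.partitionFn β (A + w • V - (h : ℂ) • B))
    (hM : ∀ w ∈ Metric.ball (0 : ℂ) R, ‖G w - G 0‖ ≤ M) :
    (Real.log (Matrix.partitionFn β (A - (h : ℂ) • B)).re
        - Real.log (Matrix.partitionFn β A).re) / β - M * (U / R)
      ≤ (Real.log (Matrix.partitionFn β (A + (U : ℂ) • V - (h : ℂ) • B)).re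
        - Real.log (Matrix.partitionFn β (A + (U : ℂ) • V)).re) / β := by
  have hR : 0 < R := lt_of_le_of_lt hU hUR
  -- Hermitian bookkeeping
  have hrealU : IsSelfAdjoint (U : ℂ) := by
    rw [isSelfAdjoint_iff, Complex.star_def, Complex.conj_ofReal]
  have hrealh : IsSelfAdjoint (h : ℂ) := by
    rw [isSelfAdjoint_iff, Complex.star_def, Complex.conj_ofReal]
  have hAU : (A + (U : ℂ) • V).IsHermitian := hA.add (hV.smul hrealU)
  have hhB : ((h : ℂ) • B).IsHermitian := hB.smul hrealh
  have hAUh : (A + (U : ℂ) • V - (h : ℂ) • B).IsHermitian := hAU.sub hhB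
  have hAh : (A - (h : ℂ) • B).IsHermitian := hA.sub hhB
  -- the two real points
  have hzU : ((U : ℝ) : ℂ) ∈ Metric.ball (0 : ℂ) R := by
    rw [Metric.mem_ball, dist_zero_right, Complex.norm_real, Real.norm_eq_abs, abs_of_nonneg hU]
    exact hUR
  have hz0 : (0 : ℂ) ∈ Metric.ball (0 : ℂ) R := Metric.mem_ball_self hR
  have eU := hexp (U : ℂ) hzU
  have e0 := hexp 0 hz0
  rw [zero_smul, add_zero] at e0
  have rU := re_eq_of_exp_mul_partitionFn hAU hAUh hβ eU
  have r0 := re_eq_of_exp_mul_partitionFn hA hAh hβ e0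
  have hmaps : Set.MapsTo (fun w => G w - G 0) (Metric.ball 0 R) (Metric.closedBall 0 M) := by
    intro w hw
    rw [Metric.mem_closedBall, dist_zero_right]
    exact hM w hw
  have key := schwarzFloor hU hUR hG hmaps
  rw [rU, r0] at key
  exact key

end Summit.HubbardSuperconductivity.HubbardSuperconductivity.Cruxes.TwSourcedCondensation.Sketch
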